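import Summits.Ventures.YMGap.RobustBall.ZNFluxWindowLayer
import Summits.Ventures.YMGap.RobustBall.FiniteGibbsInfluenceV
import HarnessLib

/-!
# RobustBall/ZNFluxLinkLayer — `ℤ_N` lattice gauge theories with finite-range flux interactions: LINK-READ Dobrushin rows
# for the block-conditioned `i`-layer system, and the windowed two-point bound `4 c^{⌈T/s⌉}` under LINK rows `≤ c`

HONEST FRAMING: venture file of the cell `pub-ymgap` (QuantumFields programme), track Y2 ROBUST-BALL, seat ds-4 g9.
Finite sums on a finite torus; no `SU(N)` measure, no area law yet (`ZNFluxLinkPeeling`); nothing about the continuum.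

WHAT THIS IS: the layer mechanism of `ZNFluxWindowLayer` (gen 8) with a SHARPER ROW ESTIMATE.  There, a term `g_t(flux k)` with
plaquette support `supp t` and sup bound `B_t` was charged the Dobrushin row `B_t (|iLinks i (supp t)| − 1)` at each of its `i`-links:
the support's fluxes read EVERY link of the support.  Here each term carries, in addition, LINK-READ data: a link set `E t` through
which `g_t ∘ flux` reads the link configuration `k` (`hE`), and per-link VARIATION bounds `δ t e ≥ |g_t(flux k) − g_t(flux k')|` for
`k, k'` differing at the single link `e` (`hδ`).  Then (`tv_layerWeightW_le_link`, from `FiniteGibbs.tv_le_of_exp_sum_var`) the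
one-site influence of the `i`-link `y'` on the `i`-link `y` is `≤ ½ ∑_{t : (y,i), (y',i) ∈ E t} δ t (y', i)` (`layerCL`), the row sums
are `≤ ½ · linkRow E δ i y`, `linkRow E δ i y = ∑_{t : (y,i) ∈ E t} ∑_{y' ≠ y, (y',i) ∈ E t} δ t (y',i)` (`rowsum_layerCL_le`), and —
the weight, its layer `ℤ_N` symmetry and the block structure being EXACTLY those of `ZNFluxWindowLayer` — the abstract two-point
engine `ZNSpin.norm_cavg_ψ_sub_le_of_shift` gives **`norm_cavg_ψ_sub_le_link`**: link rows `½ linkRow ≤ c ≤ 1` and `j`-extent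
`≤ s` of every `E t` ⇒ `‖E ψ(σ_b − σ_t)‖ ≤ 4 · c^{⌈dist_j(t,b)/s⌉}`.  WHY: for the twist defect `W_X(ζ_k U) − W_X(U)` of a polymer
activity, `E = links of X` and `δ(e) = 2√N · Lip_e(W_X)`, so the rows become `√N ×` the cross-Lipschitz load of the robust ball —
no counting constant (`CentreTubeLink`).  The gen-8 format is the case `E t = linksOf (supp t)`, `δ t ≡ 2 B_t`
(`linkRow_linksOf_le`).  References for the mechanism: Mack–Petkova 1979 §2; Durhuus–Fröhlich 1980; Georgii 2011 Prop. 8.8 / Thm. 8.20.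
-/

noncomputable section

open Finset Function
open Literature.MathematicalPhysics.QuantumFieldTheory

namespace Summit.Ventures.YMGap.RobustBall

namespace ZNFluxW

open ZN

variable {d L N : ℕ} [NeZero L] [NeZero N] {ι : Type*} [Fintype ι]

/-! ### Links of a plaquette set; fluxes read only them -/

/-- The links of a plaquette set: `(y, v)` with `y ∈ iLinks v Y`. [folklore] -/
def linksOf (Y : Finset (Plaquette d L)) : Finset (Edge d L) := Finset.univ.filter fun e => e.1 ∈ iLinks e.2 Y

omit [NeZero N] in
/-- Membership of a link in `linksOf`. [folklore] -/
@[simp] theorem mk_mem_linksOf {Y : Finset (Plaquette d L)} {y : Site d L} {v : Fin d} :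
    (y, v) ∈ linksOf Y ↔ y ∈ iLinks v Y := by
  simp [linksOf]

omit [NeZero L] [NeZero N] in
/-- The four links of a plaquette, as `iSites` memberships. [folklore] -/
theorem mem_iSites_corners (p : Plaquette d L) :
    p.1 ∈ iSites p.2.1.1 p ∧ p.1.shift p.2.1.1 ∈ iSites p.2.1.2 p ∧ p.1.shift p.2.1.2 ∈ iSites p.2.1.1 p ∧
      p.1 ∈ iSites p.2.1.2 p := by
  obtain ⟨z, ⟨⟨a, b⟩, hab⟩⟩ := p
  have hab' : a < b := hab
  have hab_ne : a ≠ b := hab'.ne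
  simp [iSites, hab_ne]

omit [NeZero N] in
/-- **Fluxes of `Y` read `k` only on `linksOf Y`.** [folklore] -/
theorem flux_congr_of_linksOf {Y : Finset (Plaquette d L)} {k k' : Edge d L → ZMod N}
    (h : ∀ e ∈ linksOf Y, k e = k' e) {p : Plaquette d L} (hp : p ∈ Y) : flux k p = flux k' p := by
  obtain ⟨h1, h2, h3, h4⟩ := mem_iSites_corners p
  have hm : ∀ {y : Site d L} {v : Fin d}, y ∈ iSites v p → (y, v) ∈ linksOf Y := fun hy =>
    mk_mem_linksOf.2 (Finset.mem_biUnion.2 ⟨p, hp, hy⟩)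
  unfold flux plaqSum
  rw [h _ (hm h1), h _ (hm h2), h _ (hm h3), h _ (hm h4)]

omit [NeZero N] [Fintype ι] in
/-- A flux-local term with plaquette support `supp t` reads `k` only on `linksOf (supp t)`. [folklore] -/
theorem apply_flux_congr_of_linksOf {supp : ι → Finset (Plaquette d L)} {g : ι → (Plaquette d L → ZMod N) → ℝ}
    (hdep : ∀ t, DependsOn (g t) (↑(supp t) : Set (Plaquette d L))) (t : ι) {k k' : Edge d L → ZMod N}
    (h : ∀ e ∈ linksOf (supp t), k e = k' e) : g t (flux k) = g t (flux k') :=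
  hdep t fun _ hp => flux_congr_of_linksOf h (Finset.mem_coe.1 hp)

/-! ### Link-read influences of the block-conditioned system -/

section Influence

variable (E : ι → Finset (Edge d L)) (δ : ι → Edge d L → ℝ) (i : Fin d)

/-- The `i`-links (by base point) of a link set. [folklore] -/
def iRead (Ei : Finset (Edge d L)) : Finset (Site d L) := Finset.univ.filter fun y => (y, i) ∈ Ei

omit [NeZero N] in
/-- Membership in `iRead`. [folklore] -/
@[simp] theorem mem_iRead {Ei : Finset (Edge d L)} {y : Site d L} : y ∈ iRead i Ei ↔ (y, i) ∈ Ei := by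
  simp [iRead]

/-- The link-read influence coefficient: `½ ∑_{t : (y,i), (y',i) ∈ E t} δ t (y', i)` (zero on the diagonal). [folklore] -/
def layerCL (y y' : Site d L) : ℝ :=
  if y' = y then 0 else (∑ t ∈ Finset.univ.filter (fun t => (y, i) ∈ E t ∧ (y', i) ∈ E t), δ t (y', i)) / 2

/-- The link-read neighbourhood: other `i`-links sharing a term's link set. [folklore] -/
def layerNbrL (y : Site d L) : Finset (Site d L) :=
  Finset.univ.filter fun y' => y' ≠ y ∧ ∃ t, (y, i) ∈ E t ∧ (y', i) ∈ E t

/-- **The link row** at the `i`-link `y`: `∑_{t : (y,i) ∈ E t} ∑_{y' ≠ y, (y',i) ∈ E t} δ t (y', i)`. [folklore] -/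
def linkRow (y : Site d L) : ℝ :=
  ∑ t ∈ Finset.univ.filter (fun t => (y, i) ∈ E t),
    ∑ y' ∈ Finset.univ.filter (fun y' => y' ≠ y ∧ (y', i) ∈ E t), δ t (y', i)

omit [NeZero L] in
/-- Influence coefficients are nonnegative (for `δ ≥ 0`). [folklore] -/
theorem layerCL_nonneg (hδ : ∀ t e, 0 ≤ δ t e) (y y' : Site d L) : 0 ≤ layerCL E δ i y y' := by
  unfold layerCL; split_ifs
  · exact le_rfl
  · exact div_nonneg (Finset.sum_nonneg fun t _ => hδ t _) (by norm_num)

/-- Link rows are nonnegative (for `δ ≥ 0`). [folklore] -/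
theorem linkRow_nonneg (hδ : ∀ t e, 0 ≤ δ t e) (y : Site d L) : 0 ≤ linkRow E δ i y :=
  Finset.sum_nonneg fun _ _ => Finset.sum_nonneg fun _ _ => hδ _ _

/-- Influence coefficients vanish off the neighbourhood. [folklore] -/
theorem layerCL_eq_zero (y y' : Site d L) (h : y' ∉ layerNbrL E i y) : layerCL E δ i y y' = 0 := by
  unfold layerCL
  split_ifs with hy
  · rfl
  · rw [layerNbrL, Finset.mem_filter, not_and] at h
    have hne : ¬∃ t, (y, i) ∈ E t ∧ (y', i) ∈ E t := fun hex => h (Finset.mem_univ _) ⟨hy, hex⟩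
    rw [Finset.filter_eq_empty_iff.2 fun t _ ht => hne ⟨t, ht⟩, Finset.sum_empty, zero_div]

/-- **One-site influences of the block-conditioned system, link-read form.** [folklore] -/
theorem tv_layerWeightW_le_link {g : ι → (Plaquette d L → ZMod N) → ℝ}
    (hE : ∀ t (k k' : Edge d L → ZMod N), (∀ e ∈ E t, k e = k' e) → g t (flux k) = g t (flux k'))
    (hδ : ∀ t (e : Edge d L) (k k' : Edge d L → ZMod N), (∀ e', e' ≠ e → k e' = k' e') →
      |g t (flux k) - g t (flux k')| ≤ δ t e)
    (H : Finset (ZMod L)) (kT : Transverse d L (ZMod N) i) (κ : Site d L → ZMod N) (y y' : Site d L) (hy : y' ≠ y)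
    (σ τ : Site d L → ZMod N) (hστ : ∀ z, z ≠ y' → σ z = τ z) :
    FiniteGibbs.tv (layerWeightW g i H kT κ) y σ τ ≤ layerCL E δ i y y' := by
  classical
  rw [layerCL, if_neg hy]
  -- glued configurations that agree on `E t` when the free spins agree on `iRead i (E t)`
  have hglueE : ∀ (t : ι) (σ σ' : Site d L → ZMod N), (∀ z ∈ (↑(iRead i (E t)) : Set (Site d L)), σ z = σ' z) →
      ∀ e ∈ E t, glue i ((block i H).piecewise σ κ) kT e = glue i ((block i H).piecewise σ' κ) kT e := by
    intro t σ σ' h e he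
    by_cases hei : e.2 = i
    · rw [glue_apply_of_eq _ _ hei, glue_apply_of_eq _ _ hei]
      by_cases hzB : e.1 ∈ block i H
      · rw [Finset.piecewise_eq_of_mem _ _ _ hzB, Finset.piecewise_eq_of_mem _ _ _ hzB]
        refine h e.1 (Finset.mem_coe.2 ((mem_iRead i).2 ?_))
        rwa [show ((e.1, i) : Edge d L) = e from Prod.ext rfl hei.symm]
      · rw [Finset.piecewise_eq_of_notMem _ _ _ hzB, Finset.piecewise_eq_of_notMem _ _ _ hzB]
    · rw [glue_apply_of_ne _ _ hei, glue_apply_of_ne _ _ hei]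
  -- glued configurations that agree off the link `(z₀, i)` when the free spins agree off `z₀`
  have hglue1 : ∀ (z₀ : Site d L) (σ σ' : Site d L → ZMod N), (∀ z, z ≠ z₀ → σ z = σ' z) →
      ∀ e', e' ≠ ((z₀, i) : Edge d L) →
        glue i ((block i H).piecewise σ κ) kT e' = glue i ((block i H).piecewise σ' κ) kT e' := by
    intro z₀ σ σ' h e' he'
    by_cases hei : e'.2 = i
    · rw [glue_apply_of_eq _ _ hei, glue_apply_of_eq _ _ hei]
      have hne : e'.1 ≠ z₀ := fun h1 => he' (Prod.ext h1 hei)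
      by_cases hzB : e'.1 ∈ block i H
      · rw [Finset.piecewise_eq_of_mem _ _ _ hzB, Finset.piecewise_eq_of_mem _ _ _ hzB, h e'.1 hne]
      · rw [Finset.piecewise_eq_of_notMem _ _ _ hzB, Finset.piecewise_eq_of_notMem _ _ _ hzB]
    · rw [glue_apply_of_ne _ _ hei, glue_apply_of_ne _ _ hei]
  have h := FiniteGibbs.tv_le_of_exp_sum_var (fun t => iRead i (E t))
    (fun t σ => g t (flux (glue i ((block i H).piecewise σ κ) kT)))
    (fun t σ σ' h => hE t _ _ (hglueE t σ σ' h)) (fun t z => δ t (z, i))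
    (fun t z σ σ' h => hδ t (z, i) _ _ (hglue1 z σ σ' h)) (w := layerWeightW g i H kT κ) (fun σ => rfl)
    (x := y) (y := y') hστ
  simpa only [mem_iRead] using h

/-- **Row sums of the link-read influences**: `∑_{y'} layerCL y y' ≤ ½ · linkRow E δ i y`. [folklore] -/
theorem rowsum_layerCL_le (hδ : ∀ t e, 0 ≤ δ t e) (y : Site d L) :
    ∑ y' ∈ layerNbrL E i y, layerCL E δ i y y' ≤ linkRow E δ i y / 2 := by
  classical
  have h1 : ∑ y' ∈ layerNbrL E i y, layerCL E δ i y y' ≤ ∑ y' ∈ Finset.univ.erase y, layerCL E δ i y y' :=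
    Finset.sum_le_sum_of_subset_of_nonneg (fun y' hy' => by
      rw [layerNbrL, Finset.mem_filter] at hy'
      exact Finset.mem_erase.2 ⟨hy'.2.1, Finset.mem_univ _⟩) fun _ _ _ => layerCL_nonneg E δ i hδ _ _
  refine h1.trans (le_of_eq ?_)
  have h2 : ∀ y' ∈ Finset.univ.erase y, layerCL E δ i y y' =
      (∑ t, (if (y, i) ∈ E t ∧ (y', i) ∈ E t then δ t (y', i) else 0)) / 2 := by
    intro y' hy'
    rw [layerCL, if_neg (Finset.mem_erase.1 hy').1, Finset.sum_filter]
  rw [Finset.sum_congr rfl h2, ← Finset.sum_div, Finset.sum_comm, linkRow, Finset.sum_filter]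
  congr 1
  refine Finset.sum_congr rfl fun t _ => ?_
  split_ifs with hyt
  · rw [Finset.sum_filter]
    refine (Finset.sum_congr rfl fun y' hy' => ?_).trans
      (Finset.sum_subset (Finset.subset_univ _) fun y' _ hy' => ?_)
    · have hne : y' ≠ y := (Finset.mem_erase.1 hy').1
      simp [hyt, hne]
    · have hy'y : y' = y := by simpa using hy'
      simp [hy'y]
  · exact Finset.sum_eq_zero fun y' _ => by simp [hyt]

end Influence

/-! ### The windowed profile along the link-read influence graph -/

omit [NeZero N] [Fintype ι] in
/-- **The profile is `1`-Lipschitz along the link-read influence graph** when the `i`-links of every `E t` have `j`-extent `≤ s`.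
[folklore] -/
theorem profile_le_of_mem_layerNbrL [Fintype ι] (E : ι → Finset (Edge d L)) (i j : Fin d) {s : ℕ} (hs : 0 < s)
    (hext : ∀ t (y y' : Site d L), (y, i) ∈ E t → (y', i) ∈ E t → jDist j y' y ≤ s) (t₀ y : Site d L)
    {y' : Site d L} (hy' : y' ∈ layerNbrL E i y) : profile j s t₀ y ≤ profile j s t₀ y' + 1 := by
  rw [layerNbrL, Finset.mem_filter] at hy'
  obtain ⟨t, hyt, hy't⟩ := hy'.2.2
  exact profile_le_of_jDist_le j hs t₀ (hext t y y' hyt hy't)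

/-! ### The windowed two-point bound under link rows -/

/-- **Two-point bound of the block-conditioned system under LINK ROWS** (`N ≥ 2`): flux-interaction terms `g_t(flux k)` reading
`k` through link sets `E t` (`hE`) with per-link variation bounds `δ t e ≥ 0` (`hδ`), link rows `½ linkRow E δ i y ≤ c ≤ 1`,
`j`-extents of the `i`-links of every `E t` `≤ s` (`0 < s`) ⇒ for every selected set `H`, transverse `kT`, frozen `κ` and sites
`b, t`: `‖E ψ(σ_b − σ_t)‖ ≤ 4 · c^{⌈dist_j(t,b)/s⌉}`.  (Nothing is asked of the plaquette supports: the layer symmetry is a property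
of fluxes.) [folklore] -/
theorem norm_cavg_ψ_sub_le_link (hN : 2 ≤ N) {E : ι → Finset (Edge d L)} {δ : ι → Edge d L → ℝ}
    {g : ι → (Plaquette d L → ZMod N) → ℝ}
    (hE : ∀ t (k k' : Edge d L → ZMod N), (∀ e ∈ E t, k e = k' e) → g t (flux k) = g t (flux k'))
    (hδ0 : ∀ t e, 0 ≤ δ t e)
    (hδ : ∀ t (e : Edge d L) (k k' : Edge d L → ZMod N), (∀ e', e' ≠ e → k e' = k' e') →
      |g t (flux k) - g t (flux k')| ≤ δ t e)
    (i j : Fin d) {c : ℝ} (hrow : ∀ y : Site d L, linkRow E δ i y / 2 ≤ c) (hc1 : c ≤ 1) {s : ℕ} (hs : 0 < s)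
    (hext : ∀ t (y y' : Site d L), (y, i) ∈ E t → (y', i) ∈ E t → jDist j y' y ≤ s)
    (H : Finset (ZMod L)) (kT : Transverse d L (ZMod N) i) (κ : Site d L → ZMod N) (b t : Site d L) :
    ‖FiniteGibbs.cavg (layerWeightW g i H kT κ) (fun σ => ψ N (σ b - σ t))‖ ≤ 4 * c ^ profile j s t b := by
  classical
  have hc0 : 0 ≤ c := (div_nonneg (linkRow_nonneg E δ i hδ0 b) (by norm_num)).trans (hrow b)
  exact ZNSpin.norm_cavg_ψ_sub_le_of_shift hN (layerWeightW_pos g i H kT κ)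
    (fun σ => layerWeightW_add_const g i H kT κ σ 1) (C := layerCL E δ i) (nbr := layerNbrL E i)
    (layerCL_nonneg E δ i hδ0) (layerCL_eq_zero E δ i)
    (fun y y' hy σ τ hστ => tv_layerWeightW_le_link E δ i hE hδ H kT κ y y' hy σ τ hστ) hc0 hc1
    (fun y => (rowsum_layerCL_le E δ i hδ0 y).trans (hrow y)) t (profile j s t) (profile_self j hs t)
    (fun y _ y' hy' => profile_le_of_mem_layerNbrL E i j hs hext t y hy') b

omit [NeZero N] in
/-- Link rows are invariant under reindexing the family. [folklore] -/
theorem linkRow_equiv {ι' : Type*} [Fintype ι'] (e : ι' ≃ ι) (E : ι → Finset (Edge d L)) (δ : ι → Edge d L → ℝ)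
    (i : Fin d) (y : Site d L) :
    linkRow (fun t => E (e t)) (fun t => δ (e t)) i y = linkRow E δ i y := by
  classical
  unfold linkRow
  rw [Finset.sum_filter, Finset.sum_filter]
  exact Fintype.sum_equiv e _ _ fun t => rfl

omit [NeZero N] in
/-- **Link rows of a combined family add** (index `ι ⊕ ι'`). [folklore] -/
theorem linkRow_sum_elim {ι' : Type*} [Fintype ι'] (E : ι → Finset (Edge d L)) (E' : ι' → Finset (Edge d L))
    (δ : ι → Edge d L → ℝ) (δ' : ι' → Edge d L → ℝ) (i : Fin d) (y : Site d L) :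
    linkRow (Sum.elim E E') (Sum.elim δ δ') i y = linkRow E δ i y + linkRow E' δ' i y := by
  classical
  unfold linkRow
  rw [Finset.sum_filter, Fintype.sum_sum_type, Finset.sum_filter, Finset.sum_filter]
  simp only [Sum.elim_inl, Sum.elim_inr]

/-! ### The gen-8 format is a special case: `E t = linksOf (supp t)`, `δ t ≡ 2 B_t` -/

omit [NeZero N] in
/-- With `E t = linksOf (supp t)` and `δ t ≡ 2B_t`, half the link row is the support row of `ZNFluxWindowLayer`:
`½ linkRow = ∑_{t ∋ y} B_t (|iLinks i (supp t)| − 1)`. [folklore] -/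
theorem linkRow_linksOf_eq (supp : ι → Finset (Plaquette d L)) (B : ι → ℝ) (i : Fin d) (y : Site d L) :
    linkRow (fun t => linksOf (supp t)) (fun t _ => 2 * B t) i y / 2 =
      ∑ t ∈ Finset.univ.filter (fun t => y ∈ iLinks i (supp t)), B t * (((iLinks i (supp t)).card : ℝ) - 1) := by
  classical
  rw [linkRow, Finset.sum_div]
  have hfilter : (Finset.univ.filter fun t => (y, i) ∈ linksOf (supp t)) =
      Finset.univ.filter fun t => y ∈ iLinks i (supp t) := by
    ext t; simp
  rw [hfilter]
  refine Finset.sum_congr rfl fun t ht => ?_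
  have hyt : y ∈ iLinks i (supp t) := (Finset.mem_filter.1 ht).2
  rw [Finset.sum_const, nsmul_eq_mul]
  have hset : (Finset.univ.filter fun y' : Site d L => y' ≠ y ∧ (y', i) ∈ linksOf (supp t)) = (iLinks i (supp t)).erase y := by
    ext y'; simp [Finset.mem_erase]
  rw [hset, Finset.card_erase_of_mem hyt, Nat.cast_sub (Finset.card_pos.2 ⟨y, hyt⟩), Nat.cast_one]
  ring

end ZNFluxW

end Summit.Ventures.YMGap.RobustBall

end
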